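import Literature.Analysis.ODE.TorusFlowHigherDerivatives
import HarnessLib

/-!
# Grönwall's inequality with a time-dependent forcing — one-sided (within-window) form

Analysis/ODE proof file (theorems only; no definitions, no named facts). The tree's
`TorusFlow.norm_le_exp_mul_integral_of_norm_deriv_le` (file `TorusFlowHigherDerivatives`) asks for a
curve differentiable at EVERY real time; its proof (the fencing theorem
`image_norm_le_of_norm_deriv_right_lt_deriv_boundary`) only consumes continuity on `[0,T]` and RIGHT
derivatives on `[0,T)`. This file records that form:

* `norm_le_exp_mul_integral_of_norm_derivWithin_le` — `y` continuous on `[0,T]`, `y(0) = 0`,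
  right-differentiable on `[0,T)` with `‖y'(t)‖ ≤ K‖y(t)‖ + ε(t)` (`K ≥ 0`, `ε ≥ 0` continuous) obeys
  `‖y(t)‖ ≤ e^{Kt} ∫₀ᵗ ε` on `[0,T]`;
* `norm_le_exp_mul_integral_of_hasDerivWithinAt_Icc_le` — the same with the derivative given within
  `[0,T]` (the shape produced by the fundamental theorem of calculus on a window, e.g.
  `TorusFlow.hasDerivWithinAt_flowJac_entry`).

Consumer: the within-window fork of Armstrong–Vicol's flow estimate (App. A Prop. 7.11) for flows that
are known only on a refresh window (cell `ad-ideate`, Lagrangian carriers).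

## References

* P. Hartman, *Ordinary Differential Equations* (2nd ed., SIAM 2002), Ch. III Thm 1.1 (Grönwall).
  [`Hartman2002`]
* S. Armstrong, V. Vicol, *Anomalous diffusion by fractal homogenization*, Ann. PDE 11 (2025),
  arXiv:2305.05048, App. A Prop. 7.11 (proof: Grönwall step). [`ArmstrongVicol2025`]
-/

noncomputable section

open Set Function Filter MeasureTheory
open scoped Topology

namespace Literature.Analysis.ODE

namespace TorusFlow

/-- **Grönwall with forcing, right derivatives on a window**: if `y` is continuous on `[0,T]`,
`y(0) = 0`, and `y` has right derivative `y'(t)` with `‖y'(t)‖ ≤ K‖y(t)‖ + ε(t)` at every `t ∈ [0,T)`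
(`K ≥ 0`, `ε ≥ 0` continuous), then `‖y(t)‖ ≤ e^{Kt} ∫₀ᵗ ε` for `t ∈ [0,T]`.
[cite: Hartman2002, Ch. III Thm 1.1] -/
theorem norm_le_exp_mul_integral_of_norm_derivWithin_le {E : Type*} [NormedAddCommGroup E]
    [NormedSpace ℝ E] {y y' : ℝ → E} {K T : ℝ} (hK : 0 ≤ K) {ε : ℝ → ℝ} (hε : Continuous ε)
    (hε0 : ∀ s, 0 ≤ ε s) (hcont : ContinuousOn y (Icc 0 T))
    (hy : ∀ t ∈ Ico 0 T, HasDerivWithinAt y (y' t) (Ici t) t) (hy0 : y 0 = 0)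
    (hb : ∀ t ∈ Ico 0 T, ‖y' t‖ ≤ K * ‖y t‖ + ε t) {t : ℝ} (ht : t ∈ Icc 0 T) :
    ‖y t‖ ≤ Real.exp (K * t) * ∫ s in (0 : ℝ)..t, ε s := by
  set Φ : ℝ → ℝ := fun u => ∫ s in (0 : ℝ)..u, ε s with hΦ
  have hΦ' : ∀ u, HasDerivAt Φ (ε u) u := fun u => (hε.integral_hasStrictDerivAt 0 u).hasDerivAt
  -- barrier with a margin `η > 0`
  have key : ∀ η : ℝ, 0 < η → ‖y t‖ ≤ Real.exp (K * t) * (Φ t + η * (t + 1)) := by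
    intro η hη
    set B : ℝ → ℝ := fun u => Real.exp (K * u) * (Φ u + η * (u + 1)) with hB
    set B' : ℝ → ℝ := fun u => K * B u + Real.exp (K * u) * (ε u + η) with hB'
    have hBd : ∀ u, HasDerivAt B (B' u) u := by
      intro u
      have he : HasDerivAt (fun u => Real.exp (K * u)) (Real.exp (K * u) * K) u := by
        have h1 : HasDerivAt (fun u : ℝ => K * u) (K * 1) u := (hasDerivAt_id u).const_mul K
        have h := (Real.hasDerivAt_exp (K * u)).comp u h1
        rw [mul_one] at h
        exact h
      have hin : HasDerivAt (fun u => Φ u + η * (u + 1)) (ε u + η) u := by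
        have h2 : HasDerivAt (fun u : ℝ => η * (u + 1)) η u := by
          simpa using ((hasDerivAt_id u).add_const 1).const_mul η
        exact (hΦ' u).add h2
      have h := he.mul hin
      refine h.congr_deriv ?_
      simp only [hB', hB]
      ring
    have h := image_norm_le_of_norm_deriv_right_lt_deriv_boundary (f := y) (f' := y') (a := 0) (b := T) hcont
      hy (B := B) (B' := B') ?_ hBd ?_ ht
    · exact h
    · rw [hy0, norm_zero]
      simp only [hB, hΦ]
      simp [hη.le]
    · intro u hu hyu
      have he1 : 1 ≤ Real.exp (K * u) := Real.one_le_exp (mul_nonneg hK hu.1)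
      calc ‖y' u‖ ≤ K * ‖y u‖ + ε u := hb u hu
        _ = K * B u + ε u := by rw [hyu]
        _ < K * B u + Real.exp (K * u) * (ε u + η) := by
            have : ε u < Real.exp (K * u) * (ε u + η) := by nlinarith [hε0 u]
            linarith
  -- let `η ↓ 0`
  refine le_of_forall_pos_le_add fun δ hδ => ?_
  have hpos : 0 < Real.exp (K * t) * (t + 1) := mul_pos (Real.exp_pos _) (by linarith [ht.1])
  have h := key (δ / (Real.exp (K * t) * (t + 1))) (div_pos hδ hpos)
  have ht1 : (t + 1) ≠ 0 := by linarith [ht.1]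
  calc ‖y t‖ ≤ Real.exp (K * t) * (Φ t + δ / (Real.exp (K * t) * (t + 1)) * (t + 1)) := h
    _ = Real.exp (K * t) * Φ t + δ := by field_simp

/-- **Grönwall with forcing, derivatives within the window**: the same conclusion when the derivative
of `y` is given WITHIN `[0,T]` at every `t ∈ [0,T]` (as the fundamental theorem of calculus on a
window produces it); continuity on `[0,T]` is then automatic. [cite: Hartman2002, Ch. III Thm 1.1] -/
theorem norm_le_exp_mul_integral_of_hasDerivWithinAt_Icc_le {E : Type*} [NormedAddCommGroup E]
    [NormedSpace ℝ E] {y y' : ℝ → E} {K T : ℝ} (hK : 0 ≤ K) {ε : ℝ → ℝ} (hε : Continuous ε)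
    (hε0 : ∀ s, 0 ≤ ε s) (hy : ∀ t ∈ Icc 0 T, HasDerivWithinAt y (y' t) (Icc 0 T) t) (hy0 : y 0 = 0)
    (hb : ∀ t ∈ Ico 0 T, ‖y' t‖ ≤ K * ‖y t‖ + ε t) {t : ℝ} (ht : t ∈ Icc 0 T) :
    ‖y t‖ ≤ Real.exp (K * t) * ∫ s in (0 : ℝ)..t, ε s := by
  have hcont : ContinuousOn y (Icc 0 T) := fun u hu => (hy u hu).continuousWithinAt
  refine norm_le_exp_mul_integral_of_norm_derivWithin_le hK hε hε0 hcont (fun u hu => ?_) hy0 hb ht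
  -- `[0,T] ∈ 𝓝[≥] u` for `u < T`, so the derivative within `[0,T]` is a right derivative
  have hmem : Icc 0 T ∈ 𝓝[Ici u] u :=
    mem_of_superset (Icc_mem_nhdsGE hu.2) (Icc_subset_Icc hu.1 le_rfl)
  exact (hy u (Ico_subset_Icc_self hu)).mono_of_mem_nhdsWithin hmem

end TorusFlow

end Literature.Analysis.ODE

end
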